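import Literature.AlgebraicGeometry.HodgeTheory.SymmetricA3SliceReduction
import Literature.AlgebraicGeometry.HodgeTheory.DiagonalSymmetryEigenHodgeNumbers
import HarnessLib

/-!
# The symmetric `A₃` point: the involution on the slice `x_j = 1` and an equivariant slice chart
# (programme B2-BIF, stage S2a, for the binder hB2 `picardLefschetz_symmetricA3` of crux K1-B)

Family `hodge`, layer `Literature/AlgebraicGeometry/HodgeTheory`, sequel of `SymmetricA3SliceReduction` (stages S0–S1:
the slice chart `IsSymmetricA3Datum.exists_sliceChart` eliminating the non-degenerate directions `(x_i)_{i ∉ {j,k}}`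
at the `A₃` point `e_j` by the implicit function theorem).  Written by the prover seat `hodge-nonav-prover-Bx` (g12,
cell `hodge-nonav`), programme memo `HOME/memos/PROGRAMME-B2BIF-Bx-g12.md`.

The datum `IsSymmetricA3Datum f₁ g₀ g₂ j k a` (hypotheses of the named fact hB2 of
`Summits/HodgeConjecture/HodgeConjecture/Theses/SignSymmetricPowers.lean`, stmt-HodgeConjecture-19716) carries a
diagonal involution `a` (`aᵢ = ±1`, `a_k a_j = −1`) stabilising `f₁, g₀, g₂`.  On the affine slice `x_j = 1` it acts
as the reflection `x ↦ a_j • (a • x)` (AGZV II §5.2: the boundary singularity `B₂` is the `ℤ/2`-symmetric `A₃`,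
the symmetry being `u ↦ −u` in the kernel coordinate `u = x_k`):

* §1 `IsSymmetricA3Datum.coe_mul_self`, `inv_eq`, `coe_j_mul_coe_k`, `one_le`, `coe_j_pow` — `aᵢ² = 1`,
  `a_j a_k = −1`, `1 ≤ d`, `a_j^d = 1` (from `g₀(e_j) ≠ 0`);
* §2 `reflect_apply_j/k`, `reflect_reflect`, `reflect_single`, `eval_reflect`, `eval_pderiv_reflect` — the
  reflection fixes `x_j`, negates `x_k`, is an involution fixing `e_j`, preserves the values of every
  `a`-symmetric form `F` of degree `d` and multiplies `∂ᵢF` by `a_j aᵢ` (chain rule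
  `aeval_diagonalSubst_pderiv_of_mem_diagonalStabilizer` + homogeneity); `mem_diagonalStabilizer_member` — every
  member `f₁ + α g₂ + β g₀` is `a`-symmetric;
* §3 `IsSymmetricA3Datum.exists_equivariantSliceChart` — the slice chart of S1 with its uniqueness box made
  reflection-stable, hence EQUIVARIANT: for a symmetric coefficient vector `c`, `(u, c) ∈ T ⇒ (−u, c) ∈ T` and
  `ψ(−u, c)` is the reflection of `ψ(u, c)` (so the reduced `∂_k`-partial is odd in `u`, stage S2b).

## References
* [ArnoldGuseinzadeVarchenko2012] AGZV II, Part I §5.2 (boundary singularities `B_k`, pp. 129–133): the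
  `ℤ/2`-equivariant reduction.
* [VoisinHodgeII2003] Voisin II, §2.1.1 Lemma 2.7 (the implicit-function chart), §6.1.3 Def. 6.9 (diagonal symmetries).
-/

noncomputable section

open MvPolynomial
open _root_.Topology _root_.Filter Set
open Literature.AlgebraicGeometry.Motives Literature.AlgebraicGeometry.Motives.UniversalHypersurface

namespace Literature.AlgebraicGeometry.HodgeTheory

section HodgeTheory

variable {n d : ℕ} {f₁ g₀ g₂ : MvPolynomial (Fin (n + 2)) ℂ} {j k : Fin (n + 2)} {a : Fin (n + 2) → ℂˣ}

namespace IsSymmetricA3Datum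

open DiscriminantBranches

/-! ### §1 The involution: `aᵢ = ±1`, `a_j a_k = −1`, `1 ≤ d`, `a_j^d = 1` -/

/-- `aᵢ² = 1`. [cite: ArnoldGuseinzadeVarchenko2012, Part I §5.2] -/
theorem coe_mul_self (hD : IsSymmetricA3Datum f₁ g₀ g₂ j k a) (i : Fin (n + 2)) :
    (a i : ℂ) * (a i : ℂ) = 1 := by
  rcases hD.2.2.2.2.2.2.2.2.2.2.2.1 i with h | h <;> rw [h] <;> norm_num

/-- `aᵢ⁻¹ = aᵢ`. [cite: ArnoldGuseinzadeVarchenko2012, Part I §5.2] -/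
theorem inv_eq (hD : IsSymmetricA3Datum f₁ g₀ g₂ j k a) (i : Fin (n + 2)) : (a i)⁻¹ = a i := by
  rw [inv_eq_iff_mul_eq_one]
  ext
  rw [Units.val_mul, Units.val_one, hD.coe_mul_self]

/-- `a_j a_k = −1`. [cite: ArnoldGuseinzadeVarchenko2012, Part I §5.2] -/
theorem coe_j_mul_coe_k (hD : IsSymmetricA3Datum f₁ g₀ g₂ j k a) : (a j : ℂ) * (a k : ℂ) = -1 := by
  rw [mul_comm]; exact hD.2.2.2.2.2.2.2.2.2.2.2.2.2.2.2

/-- The degree is positive (`∂ₖ⁴f₁(e_j) ≠ 0` rules out constant `f₁`). [cite: ArnoldGuseinzadeVarchenko2012, Part I §5.2] -/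
theorem one_le (hf₁ : f₁.IsHomogeneous d) (hD : IsSymmetricA3Datum f₁ g₀ g₂ j k a) : 1 ≤ d := by
  by_contra hlt
  have hd0 : d = 0 := by omega
  subst hd0
  have hq := hD.quartic_ne
  by_cases h0 : f₁ = 0
  · simp [h0] at hq
  · have htot : f₁.totalDegree = 0 := hf₁.totalDegree h0
    rw [totalDegree_eq_zero_iff_eq_C] at htot
    rw [htot] at hq
    simp at hq

/-- `a_j^d = 1` (apply the symmetry of `g₀` at `e_j`, where `g₀(e_j) ≠ 0`). [cite: ArnoldGuseinzadeVarchenko2012, Part I §5.2] -/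
theorem coe_j_pow (hg₀ : g₀.IsHomogeneous d) (hD : IsSymmetricA3Datum f₁ g₀ g₂ j k a) : (a j : ℂ) ^ d = 1 := by
  have h1 := eval_smul_of_mem_diagonalStabilizer hD.mem_diagonalStabilizer.2.1 (Pi.single j 1)
  have h2 : a • (Pi.single j (1 : ℂ) : Fin (n + 2) → ℂ) = (a j : ℂ) • (Pi.single j (1 : ℂ) : Fin (n + 2) → ℂ) := by
    funext i
    rw [smul_apply_eq_mul, Pi.smul_apply, smul_eq_mul]
    by_cases h : i = j
    · subst h; simp
    · simp [Pi.single_eq_of_ne h]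
  rw [h2, eval_smul_of_isHomogeneous hg₀] at h1
  exact (mul_eq_right₀ hD.eval_g₀_ne).1 h1

/-- `a_j^{d-1} = a_j`. [cite: ArnoldGuseinzadeVarchenko2012, Part I §5.2] -/
theorem coe_j_pow_pred (hf₁ : f₁.IsHomogeneous d) (hg₀ : g₀.IsHomogeneous d) (hD : IsSymmetricA3Datum f₁ g₀ g₂ j k a) :
    (a j : ℂ) ^ (d - 1) = a j := by
  obtain ⟨e, he⟩ : ∃ e, d = e + 1 := ⟨d - 1, by have := hD.one_le hf₁; omega⟩
  have h := hD.coe_j_pow hg₀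
  rw [he, pow_succ] at h
  rw [he, Nat.add_sub_cancel]
  calc (a j : ℂ) ^ e = (a j : ℂ) ^ e * ((a j : ℂ) * (a j : ℂ)) := by rw [hD.coe_mul_self, mul_one]
    _ = a j := by rw [← mul_assoc, h, one_mul]

/-- Every member `f₁ + α g₂ + β g₀` of the symmetric unfolding is `a`-symmetric.
[cite: ArnoldGuseinzadeVarchenko2012, Part I §5.2] -/
theorem mem_diagonalStabilizer_member (hD : IsSymmetricA3Datum f₁ g₀ g₂ j k a) (α β : ℂ) :
    a ∈ diagonalStabilizer (f₁ + α • g₂ + β • g₀) := by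
  obtain ⟨h1, h0, h2⟩ := hD.mem_diagonalStabilizer
  rw [mem_diagonalStabilizer_iff] at h1 h0 h2 ⊢
  rw [map_add, map_add, map_smul, map_smul, h1, h0, h2]

/-! ### §2 The reflection `x ↦ a_j • (a • x)` of the slice `x_j = 1` -/

/-- The reflection fixes the `j`-coordinate. [cite: ArnoldGuseinzadeVarchenko2012, Part I §5.2] -/
theorem reflect_apply_j (hD : IsSymmetricA3Datum f₁ g₀ g₂ j k a) (x : Fin (n + 2) → ℂ) :
    ((a j : ℂ) • (a • x)) j = x j := by
  rw [Pi.smul_apply, smul_eq_mul, smul_apply_eq_mul, ← mul_assoc, hD.coe_mul_self, one_mul]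

/-- The reflection negates the kernel coordinate `x_k`. [cite: ArnoldGuseinzadeVarchenko2012, Part I §5.2] -/
theorem reflect_apply_k (hD : IsSymmetricA3Datum f₁ g₀ g₂ j k a) (x : Fin (n + 2) → ℂ) :
    ((a j : ℂ) • (a • x)) k = -x k := by
  rw [Pi.smul_apply, smul_eq_mul, smul_apply_eq_mul, ← mul_assoc, hD.coe_j_mul_coe_k]
  ring

/-- The reflection is an involution. [cite: ArnoldGuseinzadeVarchenko2012, Part I §5.2] -/
theorem reflect_reflect (hD : IsSymmetricA3Datum f₁ g₀ g₂ j k a) (x : Fin (n + 2) → ℂ) :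
    (a j : ℂ) • (a • ((a j : ℂ) • (a • x))) = x := by
  funext i
  simp only [Pi.smul_apply, smul_eq_mul, smul_apply_eq_mul]
  calc (a j : ℂ) * ((a i : ℂ) * ((a j : ℂ) * ((a i : ℂ) * x i)))
        = ((a j : ℂ) * (a j : ℂ)) * ((a i : ℂ) * (a i : ℂ)) * x i := by ring
    _ = x i := by rw [hD.coe_mul_self, hD.coe_mul_self, one_mul, one_mul]

/-- The reflection fixes the `A₃` point `e_j`. [cite: ArnoldGuseinzadeVarchenko2012, Part I §5.2] -/
theorem reflect_single (hD : IsSymmetricA3Datum f₁ g₀ g₂ j k a) :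
    (a j : ℂ) • (a • (Pi.single j (1 : ℂ) : Fin (n + 2) → ℂ)) = Pi.single j 1 := by
  funext i
  simp only [Pi.smul_apply, smul_eq_mul, smul_apply_eq_mul]
  by_cases h : i = j
  · subst h; rw [Pi.single_eq_same, mul_one, hD.coe_mul_self]
  · rw [Pi.single_eq_of_ne h, mul_zero, mul_zero]

/-- An `a`-symmetric form of degree `d` takes the same value at reflected points.
[cite: VoisinHodgeII2003, §6.1.3 Def. 6.9] -/
theorem eval_reflect (hg₀ : g₀.IsHomogeneous d) (hD : IsSymmetricA3Datum f₁ g₀ g₂ j k a)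
    {F : MvPolynomial (Fin (n + 2)) ℂ} (hF : F.IsHomogeneous d) (ha : a ∈ diagonalStabilizer F)
    (x : Fin (n + 2) → ℂ) : eval ((a j : ℂ) • (a • x)) F = eval x F := by
  rw [eval_smul_of_isHomogeneous hF, eval_smul_of_mem_diagonalStabilizer ha, hD.coe_j_pow hg₀, one_mul]

/-- **Chain rule under the reflection**: for an `a`-symmetric form `F` of degree `d`,
`(∂ᵢF)(a_j • (a • x)) = a_j aᵢ · (∂ᵢF)(x)` (`(∂ᵢF)(a • x) = aᵢ⁻¹ ∂ᵢF(x)`, `aᵢ⁻¹ = aᵢ`, and `∂ᵢF` is homogeneous of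
degree `d − 1` with `a_j^{d-1} = a_j`). [cite: VoisinHodgeII2003, §6.1.3 Def. 6.9] -/
theorem eval_pderiv_reflect (hf₁ : f₁.IsHomogeneous d) (hg₀ : g₀.IsHomogeneous d)
    (hD : IsSymmetricA3Datum f₁ g₀ g₂ j k a) {F : MvPolynomial (Fin (n + 2)) ℂ} (hF : F.IsHomogeneous d)
    (ha : a ∈ diagonalStabilizer F) (x : Fin (n + 2) → ℂ) (i : Fin (n + 2)) :
    eval ((a j : ℂ) • (a • x)) (pderiv i F) = (a j : ℂ) * (a i : ℂ) * eval x (pderiv i F) := by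
  rw [eval_smul_of_isHomogeneous hF.pderiv, hD.coe_j_pow_pred hf₁ hg₀, ← eval_aeval_diagonalSubst,
    aeval_diagonalSubst_pderiv_of_mem_diagonalStabilizer ha i, hD.inv_eq, Units.smul_def, smul_eval, mul_assoc]

/-- In particular the reflection preserves the vanishing of each partial. [cite: VoisinHodgeII2003, §6.1.3 Def. 6.9] -/
theorem eval_pderiv_reflect_eq_zero_iff (hf₁ : f₁.IsHomogeneous d) (hg₀ : g₀.IsHomogeneous d)
    (hD : IsSymmetricA3Datum f₁ g₀ g₂ j k a) {F : MvPolynomial (Fin (n + 2)) ℂ} (hF : F.IsHomogeneous d)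
    (ha : a ∈ diagonalStabilizer F) (x : Fin (n + 2) → ℂ) (i : Fin (n + 2)) :
    eval ((a j : ℂ) • (a • x)) (pderiv i F) = 0 ↔ eval x (pderiv i F) = 0 := by
  rw [hD.eval_pderiv_reflect hf₁ hg₀ hF ha]
  refine ⟨fun h => ?_, fun h => by rw [h, mul_zero]⟩
  rcases mul_eq_zero.1 h with h' | h'
  · exact absurd h' (mul_ne_zero (Units.ne_zero _) (Units.ne_zero _))
  · exact h'

/-- And negates the `k`-th partial: `(∂ₖF)(a_j • (a • x)) = −(∂ₖF)(x)`. [cite: ArnoldGuseinzadeVarchenko2012, Part I §5.2] -/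
theorem eval_pderiv_k_reflect (hf₁ : f₁.IsHomogeneous d) (hg₀ : g₀.IsHomogeneous d)
    (hD : IsSymmetricA3Datum f₁ g₀ g₂ j k a) {F : MvPolynomial (Fin (n + 2)) ℂ} (hF : F.IsHomogeneous d)
    (ha : a ∈ diagonalStabilizer F) (x : Fin (n + 2) → ℂ) :
    eval ((a j : ℂ) • (a • x)) (pderiv k F) = -eval x (pderiv k F) := by
  rw [hD.eval_pderiv_reflect hf₁ hg₀ hF ha, hD.coe_j_mul_coe_k, neg_one_mul]

/-! ### §3 The equivariant slice chart -/

/-- **Equivariant slice chart at the symmetric `A₃` point.**  The slice chart of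
`IsSymmetricA3Datum.exists_sliceChart` (open `T ∋ (0, coeffsOf f₁)` in the free coordinates `(u, c) = (x_k, c)`,
open box `Ω ∋ (e_j, coeffsOf f₁)`, `ψ` analytic on `T` with `ψ(u, c) = (x, c) ∈ Ω`, `x_j = 1`, `x_k = u`,
`∂ᵢF_c(x) = 0 (i ∉ {j, k})`, `ψ(0, coeffsOf f₁) = (e_j, coeffsOf f₁)`, uniqueness in `Ω`) can be chosen with `Ω`
stable under the reflection `(x, c) ↦ (a_j • (a • x), c)`; consequently it is EQUIVARIANT: whenever `(u, c) ∈ T`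
and the form `F_c` is `a`-symmetric, also `(−u, c) ∈ T` and `ψ(−u, c) = (a_j • (a • x), c)` where `(x, c) = ψ(u, c)`
(the reflected point lies in `Ω`, has `x_j = 1`, `x_k = −u` and the same vanishing partials by
`eval_pderiv_reflect_eq_zero_iff`, so uniqueness applies).  This is the `ℤ/2`-equivariance of the reduction to
the kernel line in AGZV II §5.2. [cite: ArnoldGuseinzadeVarchenko2012, Part I §5.2]
[cite: VoisinHodgeII2003, §2.1.1 Lemma 2.7] -/
theorem exists_equivariantSliceChart (hf₁ : f₁.IsHomogeneous d) (hg₀ : g₀.IsHomogeneous d)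
    (hD : IsSymmetricA3Datum f₁ g₀ g₂ j k a) :
    ∃ (T : Set (Unit ⊕ DegIndex n d → ℂ)) (Ω : Set (JVar n d → ℂ))
      (ψ : (Unit ⊕ DegIndex n d → ℂ) → (JVar n d → ℂ)),
      IsOpen T ∧ IsOpen Ω ∧ Sum.elim (Pi.single j (1 : ℂ)) (coeffsOf n d f₁) ∈ Ω ∧ AnalyticOnNhd ℂ ψ T ∧
      Sum.elim (fun _ : Unit => (0 : ℂ)) (coeffsOf n d f₁) ∈ T ∧
      ψ (Sum.elim (fun _ : Unit => (0 : ℂ)) (coeffsOf n d f₁)) = Sum.elim (Pi.single j (1 : ℂ)) (coeffsOf n d f₁) ∧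
      (∀ w ∈ T, ψ w ∈ Ω ∧ prA n d (ψ w) = (fun m => w (Sum.inr m)) ∧ ψ w (Sum.inl k) = w (Sum.inl ()) ∧
        ψ w (Sum.inl j) = 1 ∧
        ∀ i, i ≠ j → i ≠ k → eval (prX n d (ψ w)) (pderiv i (formOfCoeffs (prA n d (ψ w)))) = 0) ∧
      (∀ z ∈ Ω, z (Sum.inl j) = 1 →
        (∀ i, i ≠ j → i ≠ k → eval (prX n d z) (pderiv i (formOfCoeffs (prA n d z))) = 0) →
        Sum.elim (fun _ : Unit => z (Sum.inl k)) (fun m => z (Sum.inr m)) ∈ T ∧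
          ψ (Sum.elim (fun _ : Unit => z (Sum.inl k)) (fun m => z (Sum.inr m))) = z) ∧
      (∀ z ∈ Ω, Sum.elim ((a j : ℂ) • (a • prX n d z)) (prA n d z) ∈ Ω) ∧
      (∀ w ∈ T, a ∈ diagonalStabilizer (formOfCoeffs fun m => w (Sum.inr m)) →
        Sum.elim (fun _ : Unit => -w (Sum.inl ())) (fun m => w (Sum.inr m)) ∈ T ∧
          ψ (Sum.elim (fun _ : Unit => -w (Sum.inl ())) (fun m => w (Sum.inr m))) =
            Sum.elim ((a j : ℂ) • (a • prX n d (ψ w))) (prA n d (ψ w))) := by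
  classical
  obtain ⟨T, Ω, ψ, hT, hΩ, hz₀, hψ, hw₀, hψw₀, hgraph, huniq⟩ := hD.exists_sliceChart hf₁
  -- the reflection on the joint space (kept opaque)
  obtain ⟨R, hR⟩ : ∃ R : (JVar n d → ℂ) → (JVar n d → ℂ),
      ∀ z, R z = Sum.elim ((a j : ℂ) • (a • prX n d z)) (prA n d z) := ⟨_, fun z => rfl⟩
  have hXR : ∀ z, prX n d (R z) = (a j : ℂ) • (a • prX n d z) := fun z => by rw [hR]; rfl
  have hAR : ∀ z, prA n d (R z) = prA n d z := fun z => by rw [hR]; rfl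
  have hRinl : ∀ z i, R z (Sum.inl i) = ((a j : ℂ) • (a • prX n d z)) i := fun z i => by rw [hR]; rfl
  have hRinr : ∀ z m, R z (Sum.inr m) = z (Sum.inr m) := fun z m => by rw [hR]; rfl
  have hRc : Continuous R := by
    have : R = fun z => Sum.elim ((a j : ℂ) • (a • prX n d z)) (prA n d z) := funext hR
    rw [this]
    refine continuous_pi fun v => ?_
    rcases v with i | m
    · simp only [Sum.elim_inl, Pi.smul_apply, smul_eq_mul, smul_apply_eq_mul, prX_apply]
      fun_prop
    · simp only [Sum.elim_inr, prA_apply]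
      fun_prop
  have hRR : ∀ z, R (R z) = z := by
    intro z
    rw [hR (R z), hXR, hAR, hD.reflect_reflect, sumElim_prX_prA]
  have hRz₀ : R (Sum.elim (Pi.single j (1 : ℂ)) (coeffsOf n d f₁)) =
      Sum.elim (Pi.single j (1 : ℂ)) (coeffsOf n d f₁) := by
    rw [hR]
    change Sum.elim ((a j : ℂ) • (a • (Pi.single j (1 : ℂ) : Fin (n + 2) → ℂ))) (coeffsOf n d f₁) = _
    rw [hD.reflect_single]
  -- the reflection-stable box and the shrunken free domain
  obtain ⟨Ω', hΩ'⟩ : ∃ Ω' : Set (JVar n d → ℂ), Ω' = Ω ∩ R ⁻¹' Ω := ⟨_, rfl⟩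
  have hΩ'o : IsOpen Ω' := by rw [hΩ']; exact hΩ.inter (hΩ.preimage hRc)
  have hΩ'sub : Ω' ⊆ Ω := by rw [hΩ']; exact inter_subset_left
  have hz₀' : Sum.elim (Pi.single j (1 : ℂ)) (coeffsOf n d f₁) ∈ Ω' := by
    rw [hΩ']; exact ⟨hz₀, by rw [mem_preimage, hRz₀]; exact hz₀⟩
  have hΩ'R : ∀ z ∈ Ω', R z ∈ Ω' := by
    intro z hz
    rw [hΩ'] at hz ⊢
    exact ⟨hz.2, by rw [mem_preimage, hRR]; exact hz.1⟩
  obtain ⟨T', hT'⟩ : ∃ T' : Set (Unit ⊕ DegIndex n d → ℂ), T' = T ∩ ψ ⁻¹' Ω' := ⟨_, rfl⟩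
  have hT'o : IsOpen T' := by rw [hT']; exact hψ.continuousOn.isOpen_inter_preimage hT hΩ'o
  have hT'sub : T' ⊆ T := by rw [hT']; exact inter_subset_left
  have hT'Ω : ∀ w ∈ T', ψ w ∈ Ω' := fun w hw => by rw [hT'] at hw; exact hw.2
  have hw₀' : Sum.elim (fun _ : Unit => (0 : ℂ)) (coeffsOf n d f₁) ∈ T' := by
    rw [hT']; exact ⟨hw₀, by rw [mem_preimage, hψw₀]; exact hz₀'⟩
  have huniq' : ∀ z ∈ Ω', z (Sum.inl j) = 1 →
      (∀ i, i ≠ j → i ≠ k → eval (prX n d z) (pderiv i (formOfCoeffs (prA n d z))) = 0) →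
      Sum.elim (fun _ : Unit => z (Sum.inl k)) (fun m => z (Sum.inr m)) ∈ T' ∧
        ψ (Sum.elim (fun _ : Unit => z (Sum.inl k)) (fun m => z (Sum.inr m))) = z := by
    intro z hz h1 hpart
    obtain ⟨hzT, hψz⟩ := huniq z (hΩ'sub hz) h1 hpart
    refine ⟨?_, hψz⟩
    rw [hT']
    exact ⟨hzT, by rw [mem_preimage, hψz]; exact hz⟩
  refine ⟨T', Ω', ψ, hT'o, hΩ'o, hz₀', hψ.mono hT'sub, hw₀', hψw₀,
    fun w hw => ⟨hT'Ω w hw, (hgraph w (hT'sub hw)).2⟩, huniq', fun z hz => by rw [← hR]; exact hΩ'R z hz,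
    fun w hw hsym => ?_⟩
  -- equivariance
  obtain ⟨-, hA, hk, hj, hpart⟩ := hgraph w (hT'sub hw)
  have hRΩ' : R (ψ w) ∈ Ω' := hΩ'R _ (hT'Ω w hw)
  have hRj : R (ψ w) (Sum.inl j) = 1 := by
    rw [hRinl, hD.reflect_apply_j]; exact hj
  have hRk : R (ψ w) (Sum.inl k) = -w (Sum.inl ()) := by
    rw [hRinl, hD.reflect_apply_k, ← hk]; rfl
  have hRm : (fun m => R (ψ w) (Sum.inr m)) = fun m => w (Sum.inr m) := by
    funext m; rw [hRinr]; exact congr_fun hA m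
  have hsym' : a ∈ diagonalStabilizer (formOfCoeffs (prA n d (ψ w))) := by rw [hA]; exact hsym
  have hRpart : ∀ i, i ≠ j → i ≠ k →
      eval (prX n d (R (ψ w))) (pderiv i (formOfCoeffs (prA n d (R (ψ w))))) = 0 := by
    intro i hij hik
    rw [hXR, hAR, hD.eval_pderiv_reflect_eq_zero_iff hf₁ hg₀ (isHomogeneous_formOfCoeffs _) hsym']
    exact hpart i hij hik
  obtain ⟨hT'', hψR⟩ := huniq' (R (ψ w)) hRΩ' hRj hRpart
  rw [hRk, hRm] at hT'' hψR
  refine ⟨hT'', ?_⟩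
  rw [hψR, hR]

end IsSymmetricA3Datum

end HodgeTheory

end Literature.AlgebraicGeometry.HodgeTheory

end
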